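import Summits.CriticalPhenomena.PercolationContinuityZ3.Theorems.Transplant.PlanarSkeletonFrmFromDefs
import Summits.CriticalPhenomena.PercolationContinuityZ3.Theorems.Transplant.SkelFrmFrom1RootHoldsQ3VR
import Summits.CriticalPhenomena.PercolationContinuityZ3.Theorems.Transplant.SkelFrm1RootHoldsQ3VR
import Summits.CriticalPhenomena.PercolationContinuityZ3.Theorems.Transplant.SkelFrmFromBChoiceResidQV
import Summits.CriticalPhenomena.PercolationContinuityZ3.Theorems.Transplant.SkelFrmBChoiceResidQV
import Summits.CriticalPhenomena.PercolationContinuityZ3.Theorems.Transplant.SkelFrmFromBChoiceRootReadDischarge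
import Summits.CriticalPhenomena.PercolationContinuityZ3.Theorems.Transplant.SkelFrmBChoiceRootReadDischarge
import Summits.CriticalPhenomena.PercolationContinuityZ3.Theorems.Transplant.SkelFrmFromBChoiceRows
import Summits.CriticalPhenomena.PercolationContinuityZ3.Theorems.Transplant.SkelFrmBChoiceRows
import Summits.CriticalPhenomena.PercolationContinuityZ3.Theorems.Transplant.SkelFrmFromBChoiceRoomV
import Summits.CriticalPhenomena.PercolationContinuityZ3.Theorems.Transplant.SkelFrmBChoiceRoomV
import Summits.CriticalPhenomena.PercolationContinuityZ3.Theorems.Transplant.SkelFrmFromBChoiceCreep2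
import Summits.CriticalPhenomena.PercolationContinuityZ3.Theorems.Transplant.SkelFrmBChoiceCreep2
import HarnessLib
import Summits.CriticalPhenomena.PercolationContinuityZ3.Theorems.Transplant.SkelFrm1RootHoldsQ3VNode
/-!
# U-WAVE PORT (RULING D-U, lead g21 2026-08-26; WAVE-U-MANIFEST v3.0 row «SkelFrm1RootHoldsQ3VNode» ↦ «SkelFrmFrom1RootHoldsQ3VNode») of the tree module
# `Transplant/SkelFrm1RootHoldsQ3VNode` onto the carrier `PlanarSkeletonFrmFrom` (frames only, cylinders connected from width `ℓ₀` on)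

ORIGINAL TITLE: N2 (frames-only node `SamePDropOfSkeletonFrm₁`, OPEN), (R) column: **THE (R) COLUMN PROP AT THE NODE TUPLE OF RECORD** —

builds on p205010 (kernel theorem, internal audit signed; external expert review pending) — nothing in this file uses p205010; NOTHING is claimed about the
OPEN node U `SamePDropOfSkeletonFrmFrom₁` (nor U_s / the end state).  Lane `prim-bschramm`, seat `prim-bschramm-p3` gen 26; helper file
(`--supports stmt-CriticalPhenomena-4575 --as helper`).  PORT RULES r1–r4 of RULING D-U: declaration order and proof texts are those of the original,
byte-identical except (i) the carrier token `PlanarSkeletonFrm ↦ PlanarSkeletonFrmFrom` (binders, `namespace`/`end` lines, qualified names of twinned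
declarations), (ii) carrier-FREE declarations of the original (φ-level `Skelφ…` blocks and namespace-only arithmetic residents) are NOT re-declared —
this file imports the original and `export`s the twin-free residents (POLICY T / treatment (m1)); residents whose statement mentions a twinned
constant are copied, (iii) every carrier-binding declaration keeps its explicit binder `(Φ : PlanarSkeletonFrmFrom G)` in its own signature (r2).  Docstrings and citations are the original's.
-/

noncomputable section

open scoped Classical

namespace Summit.CriticalPhenomena.PercolationContinuityZ3.Theorems.Transplant

open MeasureTheory Literature.Probability.Percolation Literature.Probability.LatticeModels SimpleGraph KNCells KNLevels
open SkelConc (Consts)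
open Skelφ.StepI (DataN DataNS OutNS)

namespace PlanarSkeletonFrmFrom

namespace NegB

open Neg

set_option maxHeartbeats 800000 in
/-- **THE (R) COLUMN PROP AT THE NODE TUPLE OF RECORD** (see the module docstring). [cite: KozmaNitzan2024, §4 p. 28 ((32) at the root)] -/
theorem rootHoldsNQWFnLK_frmChoiceAllQ3V_node (Kmin mk : ℕ) (hKmin : 200 ≤ Kmin) (mxR : PlanarSkeletonFrmFrom.NegB.GSlot) :
    RootHoldsNQWFnLK LfQ Kmin (frmChoiceAllQ3V (KS.gT mk (gxQ mk (gxR0 mk) (fxR mk))) (KS.fT mk (fxQ mk (fxR mk))) (KS.PR mk (PxQ mk (PxR mk)))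
      (SUS (exQ mk (exR0 mk)) (mxQ mxR)) (cR2W mk) (hFR mk) BSlot.small3) := by
  refine rootHoldsNQWFnLK_frmChoiceAllQ3V_R Kmin mk hKmin (KS.gT mk (gxQ mk (gxR0 mk) (fxR mk))) (KS.fT mk (fxQ mk (fxR mk))) (KS.PR mk (PxQ mk (PxR mk))) (exQ mk (exR0 mk)) (mxQ mxR) (cR2W mk) (hFR mk) BSlot.small3
    ?_ ?_ ?_ ?_ ?_ ?_ ?_ ?_ ?_
  · -- HgR
    intro κ V _ _ G _ Φ t p D
    obtain ⟨h1, -, h3⟩ := le_gT_gxQ mk (gxR0 mk) (fxR mk) κ Φ t p D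
    obtain ⟨g1, g2, -⟩ := gxC_floors κ Φ t p D mk
    exact ⟨g1.trans h1, g2.trans h1, h3, two_fT_le_gT mk (gxR0 mk) (fxR mk) κ Φ t p D⟩
  · -- HfR
    intro κ V _ _ G _ Φ t p D
    exact (le_fT_fxQ mk (fxR mk) κ Φ t p D).2.2
  · -- HexR
    intro κ V _ _ G _ Φ t p D g f
    exact (le_exQ mk (exR0 mk) κ Φ t p D g f).2.2.2.2
  · -- HPx
    intro κ V _ _ G _ Φ t p D
    exact (subset_PR_PxQ mk κ Φ t p D (PxR mk)).1
  · -- HRs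
    intro κ V _ _ G _ Φ t p D f hN hκ i
    have h1 := RA'_le_r_TA κ Φ t p D mk (gxQ mk (gxR0 mk) (fxR mk)) f hN hκ i
    have h2 := (KS.T₀a_lt_RA' κ Φ t p D mk).2.1
    have h3 : ((KS.Rs t D mk : ℕ) : ℤ) + 2 < ((fcellsA κ Φ t p D ((KS.gT mk (gxQ mk (gxR0 mk) (fxR mk))) κ Φ t p D) f).r i : ℤ) := lt_of_lt_of_le (by exact_mod_cast h2) h1
    omega
  · -- HX1
    intro κ V _ _ G _ Φ t p hC O q hK hAt
    have hN := eqNumL_of_atQ (atQ3_of_atQ3V hAt)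
    obtain ⟨h1, -, -⟩ := le_gT_gxQ mk (gxR0 mk) (fxR mk) κ Φ t p O.merged
    obtain ⟨g1, g2, -⟩ := gxC_floors κ Φ t p O.merged mk
    exact rowX1_Q κ Φ t p O.merged _ _ mk (PlanarSkeletonNeg.Neg.kq_ge_of_le κ (m := 4) (le_trans (by norm_num) hK)) hN (g1.trans h1) (g2.trans h1)
  · -- HXA
    intro κ V _ _ G _ Φ t p hC O q hK hAt hg
    have hN := eqNumL_of_atQ (atQ3_of_atQ3V hAt)
    obtain ⟨h1, -, -⟩ := le_gT_gxQ mk (gxR0 mk) (fxR mk) κ Φ t p O.merged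
    obtain ⟨-, g2, -⟩ := gxC_floors κ Φ t p O.merged mk
    have r := rowXA_Q κ Φ t p O.merged (gOf κ Φ t p O (KS.gT mk (gxQ mk (gxR0 mk) (fxR mk)))) (fOf κ Φ t p O (KS.fT mk (fxQ mk (fxR mk)))) mk
      (PlanarSkeletonNeg.Neg.kq_ge_of_le κ (m := 4) (le_trans (by norm_num) hK)) hN hg (g2.trans h1)
    have e := bOf_small3_eq κ Φ t p O (KS.gT mk (gxQ mk (gxR0 mk) (fxR mk))) (KS.fT mk (fxQ mk (fxR mk)))
    rw [← e] at r
    exact r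
  · -- HX2
    intro κ V _ _ G _ Φ t p hC O q hK hAt
    have hN := eqNumL_of_atQ (atQ3_of_atQ3V hAt)
    obtain ⟨h1, -, -⟩ := le_gT_gxQ mk (gxR0 mk) (fxR mk) κ Φ t p O.merged
    obtain ⟨g1, g2, -⟩ := gxC_floors κ Φ t p O.merged mk
    exact rowX2_Q κ Φ t p O.merged _ _ mk hN (g1.trans h1) (g2.trans h1)
  · -- HYA
    intro κ V _ _ G _ Φ t p hC O q hK hAt hg
    have hN := eqNumL_of_atQ (atQ3_of_atQ3V hAt)
    obtain ⟨h1, -, -⟩ := le_gT_gxQ mk (gxR0 mk) (fxR mk) κ Φ t p O.merged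
    obtain ⟨-, g2, -⟩ := gxC_floors κ Φ t p O.merged mk
    have r := rowYA_Q κ Φ t p O.merged (gOf κ Φ t p O (KS.gT mk (gxQ mk (gxR0 mk) (fxR mk)))) (fOf κ Φ t p O (KS.fT mk (fxQ mk (fxR mk)))) mk
      (PlanarSkeletonNeg.Neg.kq_ge_of_le κ (m := 4) (le_trans (by norm_num) hK)) hN hg (g2.trans h1)
    have e := bOf_small3_eq κ Φ t p O (KS.gT mk (gxQ mk (gxR0 mk) (fxR mk))) (KS.fT mk (fxQ mk (fxR mk)))
    rw [← e] at r
    exact r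

end NegB

end PlanarSkeletonFrmFrom

end Summit.CriticalPhenomena.PercolationContinuityZ3.Theorems.Transplant

end
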